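import Summits.ValiantsHypothesis.ValiantsHypothesis.Theses.DetQP
import Literature.Computability.AlgebraicComplexity.LandsbergRessayreProofs
import Literature.Computability.AlgebraicComplexity.GrenetEquivariant
import Literature.Computability.AlgebraicComplexity.DeterminantalComplexityProofs
import Summits.ValiantsHypothesis.ValiantsHypothesis.Theorems.DetqpThesis.Negative.NotQPBoundedOfExp
import Summits.ValiantsHypothesis.ValiantsHypothesis.Theorems.FreeFermionCLLDcqpToVH

/-!
# Line `torus-rung` — LADDER skeleton for crux `DetQP.DetqpThesis` (stmt-ValiantsHypothesis-0315;
# = `UlrichPadded.Target` = `ScaledPencil.DcPerNotQP`, literally the same term)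

Forward generator G4 `ladder-down`, unit `fwd-ladder-ValiantsHypothesis-55`
(planner-fwd-ladder-ValiantsHypothesis-55-0, 2026-08-17).  Namespace
`Summit.ValiantsHypothesis.ValiantsHypothesis.Cruxes.DetqpThesis.TorusRung`.

**Crux (fixed, the ladder TOP).** `X := ¬ IsQPBounded (fun n => dc (perPoly (Fin n) ℂ))`
(kernel-iff to the Extended Valiant Hypothesis, `detqpThesis_iff_extendedValiantHypothesis`;
tribunal verdict summit-strength — so this file works DOWN from it and never restates it).

**Gradation (the SYMMETRY ladder, Landsberg–Ressayre's `edc_Γ`).** For a family of subgroups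
`Γ m ≤ GL(m²)` of linear substitutions of the `m²` variables,
`SymRung Γ` := "for every template constant `c` some `m ≥ 3` has ALL `Γ m`-equivariant affine
determinantal representations of `per_m` (exact lifts, `IsEquivariantDetRepr`, LR17 Def. 1.3) of size
`> 2 ^ ((log₂ m + c) ^ c)`".  It is antitone in `Γ` (`symRung_mono`) and

* `SymRung ⊥ ↔ X` (`symRung_bot_iff`, proved): the top of the ladder is the bottom group;
* `SymRung (leftMonomialSubst ℂ)` — `Γ = N(T^{GL(E)})`, left multiplication by monomial matrices — is
  Landsberg–Ressayre 2017 Thm 2.8 (`2^m - 1 ≤ size`), KERNEL-CHECKED in the tree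
  (`lr_left_equivariant_lower_holds`; here `symRung_leftMonomial`): the FLOOR = witness;
* the NEXT RUNG drops the permutation half of the floor's hypothesis:
  `TorusRung := SymRung leftTorusSubst`, `leftTorusSubst m` = the substitutions `x ↦ diag(d) · x`
  (`diag(d) ⊗ 1`, `d` entrywise non-zero), i.e. `T^{GL(E)} < N(T^{GL(E)})`.

**Registered stubs (2).**
* `stub_torusRung : TorusRung` — THE RUNG (load-bearing for the ladder; conjecture-grade but strictly
  BELOW `X`: `X → TorusRung` is `torusRung_of_detqpThesis`, proved).  Exponential form
  `TorusRungExp` (`2^m - 1 ≤ size`) would be TIGHT: Grenet's representation is left-torus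
  equivariant (`hasEquivariantDetRepr_leftTorus`, proved from `Grenet.hasEquivariantDetRepr_perPoly_twoSidedTorus`).
  Located stopping point of the floor's proof: LR's weight count needs the `𝔖_m`-lifts
  (`LRWeightCount.full_of_ne_empty` / `supp_eq_univ_of_escape`: transitivity of `𝔖_m` on `s`-subsets
  gives `dim ≥ C(m,s)`); with the torus alone the same count gives only `n ≥ m`.  Strength calibration:
  a row-set-multilinear ABP of size `s` for `per_m` (Arvind–Raja 2016: typed nodes `I_v ⊆ [m]`) is a
  left-torus-equivariant representation of size `s - 1` (diagonal vertex scalings `Λ(v) = ∏_{i ∈ I_v} d_i`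
  are exact lifts, exactly as in `GrenetEquivariant.lean`), so `TorusRung` implies super-quasi-polynomial
  set-multilinear ABP lower bounds for the permanent — open (Arvind–Raja 2016, Remark 1), implying
  superpolynomial set-multilinear-circuit and noncommutative-circuit lower bounds for `per`.
* `stub_symToTorus : SymToTorus` — THE GAP ("passage from equivariant to plain `dc`"): uniform
  quasi-polynomial LEFT-TORUS symmetrisation of the permanent's determinantal representations.  It is the
  left-torus weakening of the filed `DetQP.DetqpSymmetrization` (stmt-0319; `symToTorus_of_detqpSymmetrization`,
  proved).  HONEST STATUS: modulo the (expected) exponential form of the rung and Grenet's equivariance it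
  is equivalent to `log₂ dc(per_m) ≥ m^{1/c} - O(1)`, i.e. it carries `X` (and more); no why-easier is
  known (LR17 Question 2.2: "no opinion").  Predicted tier C.  The line's content is the RUNG.

**Composition (kernel-checked, no sorry outside the stubs).**
`detqpThesis_of_torusRung_of_symToTorus : TorusRung → SymToTorus → ¬ IsQPBounded (n ↦ dc per_n)` (the
hypothesis form; `qp ∘ qp = qp`, `qp_comp`), `DetqpThesis_of : DetQP.DetqpThesis` BY NAME modulo exactly
`stub_torusRung`, `stub_symToTorus`, and `valiantsHypothesis_of : ValiantsHypothesis` through the route's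
deciding theorem `DetQP.closes` (`DcqpToVH` = stmt-3786, discharged by the landed `dcqpToVH_proof`).

F-checks (bc/probe.lean, bc/probe7.out in the seat folder): on-path `X → TorusRung` PROVED;
`TorusRung → X`, `SymToTorus → X`, `TorusRung → ValiantsHypothesis`, `SymToTorus → ValiantsHypothesis`,
real-step `lr_left_equivariant_lower → TorusRung`, outright `TorusRung` / `SymToTorus`, and
`TorusRung ↔ SymToTorus` all FAIL under `exact? | simpa | aesop`; `#h21_crux_probe` VERDICT: CLEAN ×4.

Sources: Landsberg–Ressayre 2017 (arXiv:1508.05788) Thm 2.1/2.8, Q 2.2, §6; Grenet 2011 Thm 1;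
Ikenmeyer–Landsberg 2016 (arXiv:1610.00159) Prop 3.1, Rem 2.5; Arvind–Raja 2016 (arXiv:1511.02308)
Remark 1, §2–3; Chatterjee–Kush–Saraf–Shpilka 2024 (arXiv:2312.15874); Bhargav–Dwivedi–Saxena 2024;
Fabris–Limaye–Srinivasan–Yehudayoff 2026 and arXiv:2604.00746 Cor 1.3 (min-partition-rank barrier for
(set-)multilinear ABPs); Mignon–Ressayre 2004 Thm 1.1.
-/

set_option linter.dupNamespace false

noncomputable section

open Matrix MvPolynomial
open scoped Kronecker
open Literature.Computability.AlgebraicComplexity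
open Summit.ValiantsHypothesis.Theorems.DetqpThesis.Negative
  (qpBound_mono exists_ge_qpExp_le not_isQPBounded_iff_frequently)

namespace Summit.ValiantsHypothesis.ValiantsHypothesis.Cruxes.DetqpThesis.TorusRung

/-- The **left torus** `T^{GL(E)}` acting on `M_m(ℂ)` by `x ↦ diag(d) · x`, realised as the subgroup
of `GL(m²)` generated by the substitutions `diag(d) ⊗ 1` (`d` entrywise non-zero).  It is the
diagonal part of Landsberg–Ressayre's `N(T^{GL(E)})` (`leftMonomialSubst ℂ m`), i.e. the left
monomial symmetries WITHOUT the permutation matrices. -/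
def leftTorusSubst (m : ℕ) : Subgroup (GL (Fin m × Fin m) ℂ) :=
  Subgroup.closure {γ | ∃ d : Fin m → ℂ, (∀ i, d i ≠ 0) ∧
    (γ : Matrix (Fin m × Fin m) (Fin m × Fin m) ℂ) =
      Matrix.diagonal d ⊗ₖ (1 : Matrix (Fin m) (Fin m) ℂ)}

/-- **The symmetry ladder.** `SymRung Γ`: for every quasi-polynomial template constant `c` there is
an `m ≥ 3` at which EVERY `Γ m`-equivariant affine determinantal representation of `per_m` over `ℂ`
has size `> 2 ^ ((log₂ m + c) ^ c)` — i.e. the `Γ`-equivariant determinantal complexity of the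
permanent is not quasi-polynomially bounded (stated over representations, so no `sInf` junk value
enters). -/
def SymRung (Γ : (m : ℕ) → Subgroup (GL (Fin m × Fin m) ℂ)) : Prop :=
  ∀ c : ℕ, ∃ m : ℕ, 3 ≤ m ∧
    ∀ (n : ℕ) (A : Matrix (Fin n) (Fin n) (MvPolynomial (Fin m × Fin m) ℂ)),
      IsEquivariantDetRepr (Γ m) (perPoly (Fin m) ℂ) A → 2 ^ ((Nat.log 2 m + c) ^ c) < n

/-- **The next rung (left torus).** Affine determinantal representations of `per_m` that respect
only the left torus `x ↦ diag(d) x` (exact lifts) have super-quasipolynomial size. -/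
def TorusRung : Prop := SymRung leftTorusSubst

/-- The natural exponential form of the rung ("Grenet is optimal among left-torus-equivariant
representations"): size `≥ 2^m - 1` for `m ≥ 3`.  Attained (`hasEquivariantDetRepr_leftTorus`). -/
def TorusRungExp : Prop :=
  ∀ m : ℕ, 3 ≤ m → ∀ (n : ℕ) (A : Matrix (Fin n) (Fin n) (MvPolynomial (Fin m × Fin m) ℂ)),
    IsEquivariantDetRepr (leftTorusSubst m) (perPoly (Fin m) ℂ) A → 2 ^ m - 1 ≤ n

/-- **The gap above the rung: quasi-polynomial torus symmetrisation.** Every affine determinantal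
representation of `per_m` of size `s` can be replaced by a LEFT-TORUS-equivariant one of size
quasi-polynomial in `s`, with one template constant uniform in `m ≥ 3`.  (The naive
homogenisation costs a factor `2^m`; this is the left-torus weakening of `DetQP.DetqpSymmetrization`.) -/
def SymToTorus : Prop :=
  ∃ c : ℕ, ∀ (m s : ℕ), 3 ≤ m → HasDetRepr (perPoly (Fin m) ℂ) s →
    ∃ s' ≤ 2 ^ ((Nat.log 2 s + c) ^ c),
      HasEquivariantDetRepr (leftTorusSubst m) (perPoly (Fin m) ℂ) s'

/-! ### The ladder structure (all proved) -/

/-- Rungs are monotone in the symmetry group: more symmetry assumed, weaker statement. -/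
theorem symRung_mono {Γ Γ' : (m : ℕ) → Subgroup (GL (Fin m × Fin m) ℂ)} (hle : ∀ m, Γ m ≤ Γ' m)
    (h : SymRung Γ) : SymRung Γ' := by
  intro c
  obtain ⟨m, hm3, hm⟩ := h c
  exact ⟨m, hm3, fun n A hA => hm n A (hA.anti (hle m))⟩

/-- **The top of the ladder is the bottom group**: `SymRung ⊥ ↔ DetqpThesis`. -/
theorem symRung_bot_iff :
    SymRung (fun _ => ⊥) ↔ Summit.ValiantsHypothesis.ValiantsHypothesis.Theses.DetQP.DetqpThesis := by
  constructor
  · rintro h ⟨c, hc⟩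
    obtain ⟨m, -, hm⟩ := h c
    obtain ⟨A, hA⟩ := hasDetRepr_determinantalComplexity_holds (perPoly (Fin m) ℂ)
    exact absurd (hc m) (not_le.2 (hm _ A (isEquivariantDetRepr_bot_iff.2 hA)))
  · intro h c
    have h' : ¬ IsQPBounded (fun n => determinantalComplexity (perPoly (Fin n) ℂ)) := h
    obtain ⟨m, hm3, hm⟩ := not_isQPBounded_iff_frequently.1 h' c 3
    exact ⟨m, hm3, fun n A hA =>
      lt_of_lt_of_le hm (determinantalComplexity_le_of_hasDetRepr ⟨A, hA.1⟩)⟩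

/-- **On-path**: the crux implies every rung of the symmetry ladder. -/
theorem symRung_of_detqpThesis (Γ : (m : ℕ) → Subgroup (GL (Fin m × Fin m) ℂ))
    (h : Summit.ValiantsHypothesis.ValiantsHypothesis.Theses.DetQP.DetqpThesis) : SymRung Γ :=
  symRung_mono (fun _ => bot_le) (symRung_bot_iff.2 h)

/-- In particular `DetqpThesis → TorusRung` (the rung lies on the path). -/
theorem torusRung_of_detqpThesis
    (h : Summit.ValiantsHypothesis.ValiantsHypothesis.Theses.DetQP.DetqpThesis) : TorusRung :=
  symRung_of_detqpThesis _ h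

/-- The left torus is contained in the left monomial group `N(T^{GL(E)})`. -/
theorem leftTorusSubst_le_leftMonomialSubst (m : ℕ) : leftTorusSubst m ≤ leftMonomialSubst ℂ m := by
  refine (Subgroup.closure_le _).2 ?_
  rintro γ ⟨d, hd, hγ⟩
  exact Subgroup.subset_closure ⟨LRPencil.diagUnit ℂ d hd, LRPencil.diagUnit_mem ℂ d hd, hγ⟩

/-- Arithmetic: the quasi-polynomial template is eventually below `2^m - 1`. -/
theorem qpExp_lt_two_pow_sub_one (c : ℕ) : ∃ m, 3 ≤ m ∧ 2 ^ ((Nat.log 2 m + c) ^ c) < 2 ^ m - 1 := by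
  obtain ⟨m, hm3, -, hexp⟩ := exists_ge_qpExp_le c 3
  refine ⟨m, hm3, ?_⟩
  have h1 : 2 ^ ((Nat.log 2 m + c) ^ c) ≤ 2 ^ (m - 1) := Nat.pow_le_pow_right (by norm_num) hexp
  have h2 : 2 ^ m = 2 * 2 ^ (m - 1) := by rw [← pow_succ']; congr 1; omega
  have h3 : 2 ≤ 2 ^ (m - 1) :=
    calc (2 : ℕ) = 2 ^ 1 := rfl
      _ ≤ 2 ^ (m - 1) := Nat.pow_le_pow_right (by norm_num) (by omega)
  omega

/-- An exponential (`2^m - 1`) equivariant lower bound gives the rung in template form. -/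
theorem symRung_of_exp {Γ : (m : ℕ) → Subgroup (GL (Fin m × Fin m) ℂ)}
    (h : ∀ m : ℕ, 3 ≤ m → ∀ (n : ℕ) (A : Matrix (Fin n) (Fin n) (MvPolynomial (Fin m × Fin m) ℂ)),
      IsEquivariantDetRepr (Γ m) (perPoly (Fin m) ℂ) A → 2 ^ m - 1 ≤ n) :
    SymRung Γ := by
  intro c
  obtain ⟨m, hm3, hlt⟩ := qpExp_lt_two_pow_sub_one c
  exact ⟨m, hm3, fun n A hA => lt_of_lt_of_le hlt (h m hm3 n A hA)⟩

/-- `TorusRungExp → TorusRung`. -/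
theorem torusRung_of_exp (h : TorusRungExp) : TorusRung := symRung_of_exp h

/-- **THE FLOOR (kernel-checked special case).** Landsberg–Ressayre 2017, Thm 2.8: the rung holds
one notch up the ladder, for the left monomial group `N(T^{GL(E)}) ⊋ T^{GL(E)}`. -/
theorem symRung_leftMonomial : SymRung (leftMonomialSubst ℂ) :=
  symRung_of_exp lr_left_equivariant_lower_holds

/-- The rung implies the floor (it is a strengthening: one hypothesis dropped). -/
theorem symRung_leftMonomial_of_torusRung (h : TorusRung) : SymRung (leftMonomialSubst ℂ) :=
  symRung_mono leftTorusSubst_le_leftMonomialSubst h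

/-- The left torus sits inside Grenet's two-sided torus. -/
theorem leftTorusSubst_le_twoSidedTorus (m : ℕ) : leftTorusSubst m ≤
    Subgroup.closure {γ : GL (Fin m × Fin m) ℂ | ∃ d e : Fin m → ℂ,
      (γ : Matrix (Fin m × Fin m) (Fin m × Fin m) ℂ) = Matrix.diagonal (fun p => d p.1 * e p.2)} := by
  refine (Subgroup.closure_le _).2 ?_
  rintro γ ⟨d, -, hγ⟩
  refine Subgroup.subset_closure ⟨d, fun _ => 1, ?_⟩
  rw [hγ, ← Matrix.diagonal_one, Matrix.diagonal_kronecker_diagonal]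

/-- **Tightness of the rung's exponential form**: Grenet's representation is left-torus
equivariant, so `per_m` HAS a left-torus-equivariant representation of size `2^m - 1`. -/
theorem hasEquivariantDetRepr_leftTorus {m : ℕ} (hm : m ≠ 0) :
    HasEquivariantDetRepr (leftTorusSubst m) (perPoly (Fin m) ℂ) (2 ^ m - 1) :=
  (Grenet.hasEquivariantDetRepr_perPoly_twoSidedTorus ℂ hm).anti (leftTorusSubst_le_twoSidedTorus m)

/-- The left torus sits inside the group of `DetQP.DetqpSymmetrization` (permutation `π = 1`). -/
theorem leftTorusSubst_le_detqpSymGroup (m : ℕ) : leftTorusSubst m ≤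
    Subgroup.closure {γ : Matrix.GeneralLinearGroup (Fin m × Fin m) ℂ |
      ∃ (π : Equiv.Perm (Fin m)) (d : Fin m → ℂ), (∀ i, d i ≠ 0) ∧
        (γ : Matrix (Fin m × Fin m) (Fin m × Fin m) ℂ) =
          Matrix.kroneckerMap (· * ·) (π.permMatrix ℂ * Matrix.diagonal d) 1} := by
  refine (Subgroup.closure_le _).2 ?_
  rintro γ ⟨d, hd, hγ⟩
  refine Subgroup.subset_closure ⟨1, d, hd, ?_⟩
  rw [hγ, Matrix.permMatrix_one, one_mul]

/-- **The gap is weaker than the filed `DetQP.DetqpSymmetrization` (stmt-0319).** -/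
theorem symToTorus_of_detqpSymmetrization
    (h : Summit.ValiantsHypothesis.ValiantsHypothesis.Theses.DetQP.DetqpSymmetrization) : SymToTorus := by
  obtain ⟨c, hc⟩ := h
  refine ⟨c, fun m s hm hs => ?_⟩
  obtain ⟨s', hs', hrep⟩ := hc m s hm hs
  exact ⟨s', hs', hrep.anti (leftTorusSubst_le_detqpSymGroup m)⟩

/-! ### Registered stubs -/

/-- **stub (THE RUNG).** Left-torus-equivariant affine determinantal representations of the permanent
have super-quasipolynomial size.  Open; strictly below the crux (`torusRung_of_detqpThesis`); one notch
below the kernel-checked Landsberg–Ressayre floor (`symRung_leftMonomial`).  Size: XL (implies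
set-multilinear ABP lower bounds for `per`, Arvind–Raja 2016 Remark 1). -/
theorem stub_torusRung : TorusRung := by
  sorry

/-- **stub (THE GAP).** Uniform quasi-polynomial left-torus symmetrisation of the permanent's
determinantal representations (left-torus weakening of `DetQP.DetqpSymmetrization`, stmt-0319).
Conjecture-grade; modulo `TorusRungExp` it carries the crux (see the module docstring). Size: XL. -/
theorem stub_symToTorus : SymToTorus := by
  sorry

/-! ### Composition: rung + gap ⇒ crux -/

/-- `qp ∘ qp = qp`: if `m ≤ 2 ^ ((log₂ n + c) ^ c)` then
`2 ^ ((log₂ m + e) ^ e) ≤ 2 ^ ((log₂ n + c') ^ c')` with `c' = (c + e + 2)²`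
(proof copied from `Theorems/IntegralOrbitsTauBurgisserDetStubChCollapseQP`, `ChCollapseQP.qp_comp`). [folklore] -/
theorem qp_comp (c e : ℕ) : ∃ c' : ℕ, ∀ n m : ℕ, m ≤ 2 ^ ((Nat.log 2 n + c) ^ c) →
    2 ^ ((Nat.log 2 m + e) ^ e) ≤ 2 ^ ((Nat.log 2 n + c') ^ c') := by
  refine ⟨(c + e + 2) * (c + e + 2), fun n m hm => Nat.pow_le_pow_right two_pos ?_⟩
  set L := Nat.log 2 n with hL
  set K := c + e + 2 with hK
  set M := L + K with hM
  have hlog : Nat.log 2 m ≤ (L + c) ^ c := by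
    have := Nat.log_mono_right (b := 2) hm
    rwa [Nat.log_pow one_lt_two] at this
  have hM1 : 1 ≤ M := by omega
  have h1 : (L + c) ^ c ≤ M ^ (c + 1) :=
    (Nat.pow_le_pow_left (by omega) c).trans (Nat.pow_le_pow_right hM1 (Nat.le_succ c))
  have h2 : e ≤ M ^ (c + 1) := (by omega : e ≤ M).trans (Nat.le_self_pow (by omega) M)
  have h3 : Nat.log 2 m + e ≤ M ^ (c + 2) :=
    calc Nat.log 2 m + e ≤ M ^ (c + 1) + M ^ (c + 1) := Nat.add_le_add (hlog.trans h1) h2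
      _ = 2 * M ^ (c + 1) := by ring
      _ ≤ M * M ^ (c + 1) := Nat.mul_le_mul_right _ (by omega)
      _ = M ^ (c + 2) := by ring
  have hKK : K ≤ K * K := Nat.le_mul_of_pos_left K (by omega)
  calc (Nat.log 2 m + e) ^ e ≤ (M ^ (c + 2)) ^ e := Nat.pow_le_pow_left h3 e
    _ = M ^ ((c + 2) * e) := by rw [← pow_mul]
    _ ≤ (L + K * K) ^ ((c + 2) * e) := Nat.pow_le_pow_left (by omega) _
    _ ≤ (L + K * K) ^ (K * K) :=
        Nat.pow_le_pow_right (by omega) (Nat.mul_le_mul (by omega) (by omega))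

/-- **Composition.** The rung and the gap give the crux: if `dc(per_·)` were qp-bounded (template
`c`), symmetrise the optimal representation of `per_m` to a left-torus-equivariant one of size
`≤ qp_{c₀}(qp_c(m)) ≤ qp_{c'}(m)`; the rung at `c'` supplies an `m` at which no such
representation exists. -/
theorem detqpThesis_of_torusRung_of_symToTorus (hR : TorusRung) (hS : SymToTorus) :
    ¬ IsQPBounded (fun n => determinantalComplexity (perPoly (Fin n) ℂ)) := by
  rintro ⟨c, hc⟩
  obtain ⟨c₀, hS⟩ := hS
  obtain ⟨c', hc'⟩ := qp_comp c c₀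
  obtain ⟨m, hm3, hm⟩ := hR c'
  obtain ⟨s', hs', A, hA⟩ :=
    hS m _ hm3 (hasDetRepr_determinantalComplexity_holds (perPoly (Fin m) ℂ))
  exact absurd (hs'.trans (hc' m _ (hc m))) (not_le.2 (hm s' A hA))

/-- **The crux BY NAME**, modulo `stub_torusRung` (the rung) and `stub_symToTorus` (the gap) only. -/
theorem DetqpThesis_of : Summit.ValiantsHypothesis.ValiantsHypothesis.Theses.DetQP.DetqpThesis :=
  detqpThesis_of_torusRung_of_symToTorus stub_torusRung stub_symToTorus

/-- Down to the sub-problem Statement through the route's deciding theorem `DetQP.closes` BY NAME; the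
second item `DcqpToVH` (stmt-ValiantsHypothesis-3786) is PROVED in the tree
(`Summit.ValiantsHypothesis.Theorems.dcqpToVH_proof`, Theorems/FreeFermionCLLDcqpToVH.lean) and discharged here. -/
theorem valiantsHypothesis_of : _root_.ValiantsHypothesis :=
  Summit.ValiantsHypothesis.ValiantsHypothesis.Theses.DetQP.closes DetqpThesis_of
    Summit.ValiantsHypothesis.Theorems.dcqpToVH_proof

end Summit.ValiantsHypothesis.ValiantsHypothesis.Cruxes.DetqpThesis.TorusRung

end
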